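import Summits.BirchSwinnertonDyer.BirchSwinnertonDyer.Theses.BiquadraticEisensteinDescent
import Summits.BirchSwinnertonDyer.BirchSwinnertonDyer.Theorems.BiquadraticEisensteinDescentHeegnerTwistCouplingInSupplySizeIndivisibleSharp

/-!
# Sketch — crux-ideate seat 2 g16, crux `HeegnerTwistCouplingInSupply` (stmt-BirchSwinnertonDyer-21381)
Idea `packet-drop-split-moment` (BSD is not proved by this).  First-lemma signatures only; everything over
existing declarations.  The analytic input (`PacketDropBound`) is stated by its number-theoretic OUTPUT (a short
non-vanishing Heegner twist, `p` split, for curves of Kodaira type `I₀*` at `p`); the transfer to the crux on the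
large-prime regime is `crux_largePrime_of_packetDrop` (size lever = tree theorem
`…SizeIndivisibleSharp.not_dvd_classNumber_of_sqrt_mul_log_lt`, PROVED).
-/

set_option linter.dupNamespace false
set_option autoImplicit false

namespace Summit.BirchSwinnertonDyer.BirchSwinnertonDyer.Cruxes.HeegnerTwistCouplingInSupply.PacketDropSplitMoment

open Literature.NumberTheory.EllipticCurves Literature.NumberTheory.EllipticCurves.Rank1Residual
open Summit.BirchSwinnertonDyer.BirchSwinnertonDyer.Theses.BiquadraticEisensteinDescent

/-- `W` (globally minimal) is a RAMIFIED QUADRATIC TWIST AT `p` of a curve with good reduction at `p`: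
for `p ≥ 5` this is Kodaira type `I₀*`, i.e. `v_p(Δ_min) = 6` (Tate's algorithm).  This is the regime of the card
(`W = E₀ ⊗ χ_{p*D'}` with `p ∤ N(E₀)`); the complementary additive CM types at a CM-inert `p` (`II, II*, III, III*`,
`v_p(Δ) ∈ {2,3,9,10}`, twist-minimal conductor `p²`, depth-zero supercuspidal) are NOT covered. [folklore] -/
def IsQuadraticAt (W : WeierstrassCurve ℚ) (p : ℕ) : Prop := padicValRat p W.Δ = 6

/-- A non-vanishing Heegner twist of size at most `X`: an imaginary quadratic `K`, `|d_K| > 4`, Heegner for `N_W`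
(so every prime of `N_W`, INCLUDING `p`, splits in `K`), `|d_K| ≤ X`, `L(W^{(d_K)}, 1) ≠ 0`. [folklore] -/
def HasHeegnerTwistBelow (W : WeierstrassCurve ℚ) [W.IsElliptic] (X : ℝ) : Prop :=
  ∃ (K : Type) (_ : Field K) (_ : NumberField K),
    IsImaginaryQuadratic K ∧ 4 < (NumberField.discr K).natAbs ∧
    SatisfiesHeegnerHypothesis (W.conductorNorm ℤ) K ∧
    (((NumberField.discr K).natAbs : ℕ) : ℝ) ≤ X ∧
    (W.quadraticTwist (NumberField.discr K : ℚ)).entireLFunction 1 ≠ 0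

/-- The size scale of the card: `X(W,p) = A · (N_W / p²)^A · p^θ` (`N_W/p²` = the `p`-free conductor `N₀D'²`). -/
noncomputable def scale (A θ : ℝ) (N p : ℕ) : ℝ := A * ((N : ℝ) / (p : ℝ) ^ 2) ^ A * (p : ℝ) ^ θ

/-- **PACKET-DROP BOUND (the card's C⁺, exponent `θ`).**  For every CM curve `W` of analytic rank `1` and every
CM-inert additive prime `p ≥ 5` of type `I₀*`, there is a non-vanishing Heegner twist (hence `p` split) with
`|d| ≤ A (N_W/p²)^A p^θ`.  The card's mechanism (second moment of `g₀|U_{p|D'|}` at level `4N₀|D'|·p`, the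
`(·/p)`-twisted moment having no main term because `a_p(E₀) = 0`) aims at EVERY `θ > 1` if `(g₀|U_p) ⊗ χ_p` keeps
level `4N₀|D'|p` (Atkin–Li/Ueda-type level preservation — the hinge), and only `θ > 2` (useless) otherwise.
Printed unconditional input: `θ = 2 + ε` WITHOUT the split condition (Hoffstein–Kontorovich 2010 Thm 1.1,
arXiv:1008.0839). [cite: arXiv:1008.0839, Thm 1.1 (the N^{1+ε} bound this sharpens in the square part)] -/
def PacketDropBound (A θ : ℝ) : Prop :=
  ∀ (W : WeierstrassCurve ℚ) [W.IsElliptic] [W.IsGloballyMinimal] (p : ℕ) [Fact p.Prime]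
    [NeZero (W.conductorNorm ℤ)],
    W.HasCM → W.analyticRank = 1 → 5 ≤ p → CMInert W p → ¬ Good W p → IsQuadraticAt W p →
      HasHeegnerTwistBelow W (scale A θ (W.conductorNorm ℤ) p)

/-- The crux `HeegnerTwistCouplingInSupply` RESTRICTED to the card's regime: type `I₀*` at `p` and `p` large
against the `p`-free conductor, in the precise form "the size scale is below the class-number threshold"
(`π⁻¹ √X log X < p`).  On this regime the supply hypothesis of the crux is not even used. -/
def CruxLargePrime (A θ : ℝ) : Prop :=
  ∀ (W : WeierstrassCurve ℚ) [W.IsElliptic] [W.IsGloballyMinimal] (p : ℕ) [Fact p.Prime]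
    [NeZero (W.conductorNorm ℤ)],
    W.HasCM → W.analyticRank = 1 → 5 ≤ p → CMInert W p → ¬ Good W p → IsQuadraticAt W p →
      4 < scale A θ (W.conductorNorm ℤ) p →
      Real.pi⁻¹ * Real.sqrt (scale A θ (W.conductorNorm ℤ) p) * Real.log (scale A θ (W.conductorNorm ℤ) p) < p →
      ∃ (K : Type) (_ : Field K) (_ : NumberField K),
        IsImaginaryQuadratic K ∧ 4 < (NumberField.discr K).natAbs ∧
        SatisfiesHeegnerHypothesis (W.conductorNorm ℤ) K ∧
        (W.quadraticTwist (NumberField.discr K : ℚ)).entireLFunction 1 ≠ 0 ∧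
        ¬ p ∣ NumberField.classNumber K

/-- Monotonicity step used by the transfer: `x ↦ π⁻¹ √x log x` is monotone on `[4, ∞)`. [folklore] -/
theorem inv_pi_sqrt_log_mono {x y : ℝ} (h4 : 4 ≤ x) (hxy : x ≤ y) :
    Real.pi⁻¹ * Real.sqrt x * Real.log x ≤ Real.pi⁻¹ * Real.sqrt y * Real.log y := by
  have hx0 : 0 < x := by linarith
  have hy0 : 0 < y := by linarith
  have hlogx : 0 ≤ Real.log x := Real.log_nonneg (by linarith)
  have h1 : Real.sqrt x ≤ Real.sqrt y := Real.sqrt_le_sqrt hxy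
  have h2 : Real.log x ≤ Real.log y := Real.log_le_log hx0 hxy
  have hpi : 0 ≤ Real.pi⁻¹ := inv_nonneg.mpr Real.pi_pos.le
  have : Real.sqrt x * Real.log x ≤ Real.sqrt y * Real.log y :=
    mul_le_mul h1 h2 hlogx (Real.sqrt_nonneg _)
  calc Real.pi⁻¹ * Real.sqrt x * Real.log x = Real.pi⁻¹ * (Real.sqrt x * Real.log x) := by ring
    _ ≤ Real.pi⁻¹ * (Real.sqrt y * Real.log y) := mul_le_mul_of_nonneg_left this hpi
    _ = Real.pi⁻¹ * Real.sqrt y * Real.log y := by ring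

/-- **FIRST LEMMA of the line (transfer, PROVED here): the packet-drop bound decides the crux on the large-prime
`I₀*` regime**, the class-number half being free by size (tree theorem
`not_dvd_classNumber_of_sqrt_mul_log_lt`, Dirichlet's bound `h ≤ π⁻¹√|d| log|d|`). -/
theorem crux_largePrime_of_packetDrop (A θ : ℝ) (h : PacketDropBound A θ) : CruxLargePrime A θ := by
  intro W _ _ p _ _ hCM hrk hp5 hinert hbad hquad h4X hsize
  obtain ⟨K, _, _, hK, h4, hHeeg, hle, hL⟩ := h W p hCM hrk hp5 hinert hbad hquad
  refine ⟨K, inferInstance, inferInstance, hK, h4, hHeeg, hL, ?_⟩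
  have h4d : (4 : ℝ) ≤ (((NumberField.discr K).natAbs : ℕ) : ℝ) := by exact_mod_cast h4.le
  exact Summit.BirchSwinnertonDyer.BirchSwinnertonDyer.Theorems.BiquadraticEisensteinDescentHeegnerTwistCouplingInSupplySizeIndivisibleSharp.not_dvd_classNumber_of_sqrt_mul_log_lt
    hK h4 ((inv_pi_sqrt_log_mono h4d hle).trans_lt hsize)

/-- The residual OFF the card's regime (what the card does NOT touch): (i) `p` small against `N_W/p²`
(the density regime of the line of record), (ii) the twist-minimal types `II/II*/III/III*` at `p`. Recorded as
the honest complement so that `PacketDropBound ∧ CruxComplement → crux` is bookkeeping. -/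
def CruxComplement (A θ : ℝ) : Prop :=
  ∀ (W : WeierstrassCurve ℚ) [W.IsElliptic] [W.IsGloballyMinimal] (p : ℕ) [Fact p.Prime]
    [NeZero (W.conductorNorm ℤ)],
    W.HasCM → W.analyticRank = 1 → 5 ≤ p → CMInert W p → ¬ Good W p →
      (¬ IsQuadraticAt W p ∨ scale A θ (W.conductorNorm ℤ) p ≤ 4 ∨
        (p : ℝ) ≤ Real.pi⁻¹ * Real.sqrt (scale A θ (W.conductorNorm ℤ) p) *
          Real.log (scale A θ (W.conductorNorm ℤ) p)) →
      (∀ B : ℕ, ∃ (K : Type) (_ : Field K) (_ : NumberField K), IsImaginaryQuadratic K ∧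
          B < (NumberField.discr K).natAbs ∧ 4 < (NumberField.discr K).natAbs ∧
          SatisfiesHeegnerHypothesis (W.conductorNorm ℤ) K ∧ ¬ p ∣ NumberField.classNumber K) →
      ∃ (K : Type) (_ : Field K) (_ : NumberField K),
        IsImaginaryQuadratic K ∧ 4 < (NumberField.discr K).natAbs ∧
        SatisfiesHeegnerHypothesis (W.conductorNorm ℤ) K ∧
        (W.quadraticTwist (NumberField.discr K : ℚ)).entireLFunction 1 ≠ 0 ∧
        ¬ p ∣ NumberField.classNumber K

/-- Bookkeeping composition (PROVED): the crux splits as (card's regime) + (complement). -/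
theorem crux_of_packetDrop_and_complement (A θ : ℝ) (h₁ : PacketDropBound A θ) (h₂ : CruxComplement A θ) :
    HeegnerTwistCouplingInSupply := by
  intro W _ _ p _ _ hCM hrk hp5 hinert hbad hsupply
  by_cases hq : IsQuadraticAt W p
  · by_cases h4X : 4 < scale A θ (W.conductorNorm ℤ) p
    · by_cases hsz : Real.pi⁻¹ * Real.sqrt (scale A θ (W.conductorNorm ℤ) p) *
          Real.log (scale A θ (W.conductorNorm ℤ) p) < p
      · exact crux_largePrime_of_packetDrop A θ h₁ W p hCM hrk hp5 hinert hbad hq h4X hsz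
      · exact h₂ W p hCM hrk hp5 hinert hbad (Or.inr (Or.inr (not_lt.mp hsz))) hsupply
    · exact h₂ W p hCM hrk hp5 hinert hbad (Or.inr (Or.inl (not_lt.mp h4X))) hsupply
  · exact h₂ W p hCM hrk hp5 hinert hbad (Or.inl hq) hsupply

end Summit.BirchSwinnertonDyer.BirchSwinnertonDyer.Cruxes.HeegnerTwistCouplingInSupply.PacketDropSplitMoment
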